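import Mathlib
import Summits.ResolutionOfSingularities.ResolutionOfSingularities.Theorems.HomologicalConductorPersistenceCyclicQuotientNumerationChain
import HarnessLib

/-!
# Rung S-2 `PersistenceSurface` (stmt-ResolutionOfSingularities-19970), stub C1 (`Sat₄`) on the toric class —
# NUMERATION LEMMA for Hirzebruch–Jung chains, part 2/3: runs of digits `2` and the run sources (N3)

Route `ResolutionOfSingularities/HomologicalConductor`, rung S-2 `PersistenceSurface` (stmt-19970), registered stub
`stub_saturationFourSurfaceResidualFour`, class (iii).  [OURS · cell decomp-res · seat leafhand-res-homologicalconduct-13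
gen 0; AI-written, weaker than expert review; NOT a statement of the manuscript under review (Hironaka 2017).]

Continuation of `…NumerationChain` (same namespace, same chain data `(e, i, b)`).  Inside a maximal run
`b t₁ = … = b t₂ = 2` the `i`'s are in arithmetic progression on `[t₁ − 1, t₂ + 1]` (`run_diff_const`, `run_shift`),
whence the FOUR-TERM IDENTITY `i u + i m = i p + i (t₂+1)` for `u + m = p + t₂ + 1` (`run_four_term`).  With the
pivot `p = t₁ − 1` (or `p = 1` when `t₁ = 1`) this yields the closed-form greedy-remainder certificates of
HAND10G2-TORIC-FAMILIES §6 (N3) for the class `i 0 − i u`, `u` in the run: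
* run ending at `t₂ < e` (`certificate_runA`, `target_runA`): remainders
  `i s − i (s+1) − i u ∣ i s − i (s+1) + i m − i (t₂+1) ∣ i s − i (s+1) − i (t₂+1) ∣ i s − i (s+1) ∣ 0` on
  `[1,p) ∣ [p,m) ∣ [m,t₂] ∣ (t₂,e) ∣ {e}`, digit `b m − 1 ≥ 1` at the target `m = p + t₂ + 1 − u`;
* run reaching `t₂ = e` (`certificate_runB`, `target_runB`): remainders `i s − i (s+1) − i u ∣ i s − i (s+1) + i m ∣ 0`
  on `[1,p) ∣ [p,m−1) ∣ [m−1,e]`, digit `b (m-1) − 1 ≥ 1` at the target `m − 1`, `m = p + e + 1 − u`.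
Every digit is checked by `omega` against the chain relation; the only structural input is the four-term identity
and the gaps below `p` (`3 ≤ b p`) and below `t₂ + 1` (`3 ≤ b (t₂+1)`).  Part 3 (`…Numeration`) assembles the lemma.
No crux, kill test or summit statement is proved here.

References: HAND10G1-QIV-RETRACT §F («reflection inside (−2)-runs»), HAND10G2-TORIC-FAMILIES §6 (N3) (OURS, cell memos).
-/

-- single-problem summit: the doubled namespace component `ResolutionOfSingularities` is forced
set_option linter.dupNamespace false

namespace Summit.ResolutionOfSingularities.ResolutionOfSingularities.Theorems.HomologicalConductor.PersistenceCyclicQuotientNumeration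

/-! ## Runs of digits `2`: the `i`'s are in arithmetic progression -/

/-- On a run `b t₁ = … = b t₂ = 2` the first differences are constant: for `t₁ − 1 ≤ a ≤ t₂`,
`i a − i (a+1) = i t₂ − i (t₂+1)`, additively. [folklore] -/
theorem run_diff_const {e t₁ t₂ : ℕ} {i b : ℕ → ℕ}
    (hrec : ∀ s, 1 ≤ s → s ≤ e → i (s - 1) + i (s + 1) = b s * i s)
    (ht₁ : 1 ≤ t₁) (ht₂ : t₂ ≤ e) (hrun : ∀ s, t₁ ≤ s → s ≤ t₂ → b s = 2) :
    ∀ a, t₁ - 1 ≤ a → a ≤ t₂ → i a + i (t₂ + 1) = i (a + 1) + i t₂ := by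
  have key : ∀ k a, a + k = t₂ → t₁ - 1 ≤ a → i a + i (t₂ + 1) = i (a + 1) + i t₂ := by
    intro k
    induction k with
    | zero => intro a ha _; rw [Nat.add_zero] at ha; subst ha; omega
    | succ k ih =>
      intro a ha hta
      have h1 := ih (a + 1) (by omega) (by omega)
      have h2 := hrec (a + 1) (by omega) (by omega)
      rw [hrun (a + 1) (by omega) (by omega), Nat.add_sub_cancel] at h2
      omega
  intro a hta hat
  exact key (t₂ - a) a (by omega) hta

/-- On a run, `i a = i (a + L) + L · (i t₂ − i (t₂+1))` whenever `t₁ − 1 ≤ a` and `a + L ≤ t₂ + 1`. [folklore] -/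
theorem run_shift {e t₁ t₂ : ℕ} {i b : ℕ → ℕ}
    (hrec : ∀ s, 1 ≤ s → s ≤ e → i (s - 1) + i (s + 1) = b s * i s)
    (ht₁ : 1 ≤ t₁) (ht₂ : t₂ ≤ e) (hrun : ∀ s, t₁ ≤ s → s ≤ t₂ → b s = 2) (hD : i (t₂ + 1) ≤ i t₂) :
    ∀ L a, t₁ - 1 ≤ a → a + L ≤ t₂ + 1 → i a = i (a + L) + L * (i t₂ - i (t₂ + 1)) := by
  intro L
  induction L with
  | zero => intro a _ _; simp
  | succ L ih =>
    intro a hta haL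
    have h1 := ih a hta (by omega)
    have h2 := run_diff_const hrec ht₁ ht₂ hrun (a + L) (by omega) (by omega)
    show i a = i (a + L + 1) + (L + 1) * (i t₂ - i (t₂ + 1))
    rw [Nat.add_mul, Nat.one_mul]
    omega

/-- **The four-term identity of a run**: for `p ≤ u` with `t₁ − 1 ≤ p`, `u ≤ t₂ + 1` and `u + m = p + t₂ + 1`,
`i u + i m = i p + i (t₂+1)` (both pairs are `L = u − p` steps apart in the arithmetic progression).
(HAND10G2 §6 (N3).) [folklore] -/
theorem run_four_term {e t₁ t₂ : ℕ} {i b : ℕ → ℕ}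
    (hrec : ∀ s, 1 ≤ s → s ≤ e → i (s - 1) + i (s + 1) = b s * i s)
    (ht₁ : 1 ≤ t₁) (ht₂ : t₂ ≤ e) (hrun : ∀ s, t₁ ≤ s → s ≤ t₂ → b s = 2) (hD : i (t₂ + 1) ≤ i t₂)
    {p u m : ℕ} (htp : t₁ - 1 ≤ p) (hpu : p ≤ u) (hut : u ≤ t₂ + 1) (hum : u + m = p + t₂ + 1) :
    i u + i m = i p + i (t₂ + 1) := by
  have h1 := run_shift hrec ht₁ ht₂ hrun hD (u - p) p htp (by omega)
  have h2 := run_shift hrec ht₁ ht₂ hrun hD (u - p) m (by omega) (by omega)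
  rw [show p + (u - p) = u by omega] at h1
  rw [show m + (u - p) = t₂ + 1 by omega] at h2
  omega

/-! ## (N3a) The run source, run ending before `e` -/

/-- **Certificate (N3a).**  Data: `1 ≤ p < u ≤ t₂ < e`, `u + m = p + t₂ + 1` (so `p < m ≤ t₂`), the four-term
identity `i u + i m = i p + i (t₂+1)`, `p = 1 ∨ 3 ≤ b p`, `3 ≤ b (t₂+1)`.  Then
`τ' 0 = i 0 − i u`, `τ' s = i s − i (s+1) − i u` on `[1,p)`, `= i s − i (s+1) + i m − i (t₂+1)` on `[p,m)`,
`= i s − i (s+1) − i (t₂+1)` on `[m,t₂]`, `= i s − i (s+1)` on `(t₂,e)`, `τ' e = 0` is a greedy-remainder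
certificate for the class `i 0 − i u`, with digit `b m − 1 ≥ 1` at `s = m` (digits elsewhere:
`b 1 − 1 ∣ b s − 2 ∣ b p − 3` (or `b 1 − 2` if `p = 1`) `∣ b (t₂+1) − 3` (or `b e − 2` if `t₂ + 1 = e`) `∣ b e − 1`).
(HAND10G2 §6 (N3), case `t₂ < e`.) [folklore] -/
theorem certificate_runA {e : ℕ} {i b τ' : ℕ → ℕ} (hie : i e = 1) (hie1 : i (e + 1) = 0)
    (hrec : ∀ s, 1 ≤ s → s ≤ e → i (s - 1) + i (s + 1) = b s * i s) (hb : ∀ s, 1 ≤ s → s ≤ e → 2 ≤ b s)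
    {u p m t₂ : ℕ} (hp1 : 1 ≤ p) (hpu : p < u) (hut : u ≤ t₂) (ht₂e : t₂ < e) (hum : u + m = p + t₂ + 1)
    (hkey : i u + i m = i p + i (t₂ + 1)) (hp : p = 1 ∨ 3 ≤ b p) (hbt : 3 ≤ b (t₂ + 1))
    (h0 : τ' 0 = i 0 - i u) (hA : ∀ s, 1 ≤ s → s < p → τ' s = i s - i (s + 1) - i u)
    (hB : ∀ s, p ≤ s → s < m → τ' s = i s - i (s + 1) + i m - i (t₂ + 1))
    (hC : ∀ s, m ≤ s → s ≤ t₂ → τ' s = i s - i (s + 1) - i (t₂ + 1))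
    (hD : ∀ s, t₂ < s → s < e → τ' s = i s - i (s + 1)) (hE : τ' e = 0) :
    ∀ s, 1 ≤ s → s ≤ e → τ' s < i s ∧ ∃ d, τ' (s - 1) = τ' s + d * i s ∧ (s = m → 1 ≤ d) := by
  intro s hs1 hse
  have h2 := two_mul_le_of_chain hrec hb
  have hrs := hrec s hs1 hse
  have hbs := hb s hs1 hse
  have h2s : 2 * i s ≤ b s * i s := Nat.mul_le_mul_right _ hbs
  have hlt := lt_of_chain hie hie1 h2 s hse
  have hlt' := lt_of_chain hie hie1 h2 (s - 1) (by omega)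
  have hs11 : s - 1 + 1 = s := by omega
  rw [hs11] at hlt'
  have hpos1 : s < e → 1 ≤ i (s + 1) := fun h => one_le_of_chain hie hie1 h2 (s + 1) (by omega)
  have hiu0 : i u ≤ i 0 := le_of_chain hie hie1 h2 0 u (by omega) (by omega)
  have hipu : i u < i p := by
    have := le_of_chain hie hie1 h2 (p + 1) u (by omega) (by omega)
    have := lt_of_chain hie hie1 h2 p (by omega); omega
  have himt : i (t₂ + 1) < i m := by
    have := le_of_chain hie hie1 h2 m t₂ (by omega) (by omega)
    have := lt_of_chain hie hie1 h2 t₂ (by omega); omega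
  have hims : s + 1 ≤ m → i m ≤ i (s + 1) := fun h => le_of_chain hie hie1 h2 (s + 1) m h (by omega)
  have hit1 : 1 ≤ i (t₂ + 1) := one_le_of_chain hie hie1 h2 (t₂ + 1) (by omega)
  -- gap below `p` (when `p ≥ 2`, `3 ≤ b p`)
  have hgapP : 3 ≤ b p → s + 1 ≤ p → i (s + 1) + i p + 1 ≤ i s :=
    fun h3 h => gap_of_three_le hie hie1 hrec hb p hp1 (by omega) h3 s h
  have hgapP' : 3 ≤ b p → s ≤ p → i s + i p + 1 ≤ i (s - 1) := fun h3 h => by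
    have := gap_of_three_le hie hie1 hrec hb p hp1 (by omega) h3 (s - 1) (by omega)
    rwa [hs11] at this
  -- gap below `t₂ + 1` (`3 ≤ b (t₂+1)`)
  have hgapT : s ≤ t₂ → i (s + 1) + i (t₂ + 1) + 1 ≤ i s :=
    fun h => gap_of_three_le hie hie1 hrec hb (t₂ + 1) (by omega) (by omega) hbt s (by omega)
  have hgapT' : s ≤ t₂ + 1 → i s + i (t₂ + 1) + 1 ≤ i (s - 1) := fun h => by
    have := gap_of_three_le hie hie1 hrec hb (t₂ + 1) (by omega) (by omega) hbt (s - 1) (by omega)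
    rwa [hs11] at this
  have h3p : 3 ≤ b p → 3 * i p ≤ b p * i p := fun h => Nat.mul_le_mul_right _ h
  have h3t : 3 * i (t₂ + 1) ≤ b (t₂ + 1) * i (t₂ + 1) := Nat.mul_le_mul_right _ hbt
  rcases Nat.lt_or_ge s p with hsp | hsp
  · -- `s < p`: here `p ≥ 2`, so `3 ≤ b p`
    have h3 : 3 ≤ b p := by rcases hp with h | h <;> omega
    have e1 : τ' s = i s - i (s + 1) - i u := hA s hs1 hsp
    have hex := hgapP h3 (by omega)
    rcases Nat.lt_or_ge 1 s with hs2 | hs2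
    · have e0 : τ' (s - 1) = i (s - 1) - i s - i u := by
        have := hA (s - 1) (by omega) (by omega); rwa [hs11] at this
      have hex' := hgapP' h3 (by omega)
      refine ⟨by omega, b s - 2, ?_, fun h => by omega⟩
      rw [Nat.sub_mul]; omega
    · have e0 : τ' (s - 1) = i 0 - i u := by rw [show s - 1 = 0 by omega]; exact h0
      have hi0 : i (s - 1) = i 0 := by rw [show s - 1 = 0 by omega]
      refine ⟨by omega, b s - 1, ?_, fun h => by omega⟩
      rw [Nat.sub_mul]; omega
  rcases Nat.lt_or_ge s m with hsm | hsm
  · -- `p ≤ s < m`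
    have e1 : τ' s = i s - i (s + 1) + i m - i (t₂ + 1) := hB s hsp hsm
    have him1 := hims (by omega)
    rcases Nat.lt_or_ge p s with hps | hps
    · -- `p < s < m`
      have e0 : τ' (s - 1) = i (s - 1) - i s + i m - i (t₂ + 1) := by
        have := hB (s - 1) (by omega) (by omega); rwa [hs11] at this
      refine ⟨by omega, b s - 2, ?_, fun h => by omega⟩
      rw [Nat.sub_mul]; omega
    · -- `s = p`
      obtain rfl : s = p := le_antisymm hps hsp
      rcases Nat.lt_or_ge 1 s with hs2 | hs2
      · have h3 : 3 ≤ b s := by rcases hp with h | h <;> omega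
        have e0 : τ' (s - 1) = i (s - 1) - i s - i u := by
          have := hA (s - 1) (by omega) (by omega); rwa [hs11] at this
        have hex' := hgapP' h3 le_rfl
        have := h3p h3
        refine ⟨by omega, b s - 3, ?_, fun h => by omega⟩
        rw [Nat.sub_mul]; omega
      · have e0 : τ' (s - 1) = i 0 - i u := by rw [show s - 1 = 0 by omega]; exact h0
        have hi0 : i (s - 1) = i 0 := by rw [show s - 1 = 0 by omega]
        refine ⟨by omega, b s - 2, ?_, fun h => by omega⟩
        rw [Nat.sub_mul]; omega
  rcases Nat.lt_or_ge t₂ s with hts | hts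
  · -- `t₂ < s`
    have e0' : s = t₂ + 1 → τ' (s - 1) = i (s - 1) - i s - i (t₂ + 1) := fun h => by
      have := hC (s - 1) (by omega) (by omega); rwa [hs11] at this
    have e0'' : t₂ + 1 < s → τ' (s - 1) = i (s - 1) - i s := fun h => by
      have := hD (s - 1) (by omega) (by omega); rwa [hs11] at this
    rcases Nat.lt_or_ge s e with hse' | hse'
    · have e1 : τ' s = i s - i (s + 1) := hD s hts hse'
      have hp1 := hpos1 hse'
      rcases Nat.lt_or_ge (t₂ + 1) s with hts' | hts'
      · -- `t₂ + 1 < s < e`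
        have e0 := e0'' hts'
        refine ⟨by omega, b s - 2, ?_, fun h => by omega⟩
        rw [Nat.sub_mul]; omega
      · -- `s = t₂ + 1 < e`
        have hst : s = t₂ + 1 := by omega
        have e0 := e0' hst
        have hex' := hgapT' (by omega)
        have hi3 : 3 * i s ≤ b s * i s := by rw [hst]; exact h3t
        have his : i s = i (t₂ + 1) := by rw [hst]
        refine ⟨by omega, b s - 3, ?_, fun h => by omega⟩
        rw [Nat.sub_mul]; omega
    · -- `s = e`
      obtain rfl : s = e := le_antisymm hse hse'
      have e1 : τ' s = 0 := hE
      rcases Nat.lt_or_ge (t₂ + 1) s with hts' | hts'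
      · have e0 := e0'' hts'
        refine ⟨by omega, b s - 1, ?_, fun h => by omega⟩
        rw [Nat.sub_mul]; omega
      · have hst : s = t₂ + 1 := by omega
        have e0 := e0' hst
        have his : i s = i (t₂ + 1) := by rw [hst]
        refine ⟨by omega, b s - 2, ?_, fun h => by omega⟩
        rw [Nat.sub_mul]; omega
  · -- `m ≤ s ≤ t₂`
    have e1 : τ' s = i s - i (s + 1) - i (t₂ + 1) := hC s hsm hts
    have hex := hgapT hts
    rcases Nat.lt_or_ge m s with hms | hms
    · -- `m < s ≤ t₂`
      have e0 : τ' (s - 1) = i (s - 1) - i s - i (t₂ + 1) := by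
        have := hC (s - 1) (by omega) (by omega); rwa [hs11] at this
      have hex' := hgapT' (by omega)
      refine ⟨by omega, b s - 2, ?_, fun h => by omega⟩
      rw [Nat.sub_mul]; omega
    · -- `s = m`: the TARGET digit `b m − 1 ≥ 1`
      obtain rfl : s = m := le_antisymm hms hsm
      have e0 : τ' (s - 1) = i (s - 1) - i s + i s - i (t₂ + 1) := by
        have := hB (s - 1) (by omega) (by omega); rwa [hs11] at this
      refine ⟨by omega, b s - 1, ?_, fun _ => by omega⟩
      rw [Nat.sub_mul]; omega

/-- **(N3a) for greedy remainders**: under the hypotheses of `certificate_runA`, every `τ` with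
`τ 0 = i 0 − i u` obeying the greedy recursion has `i m ≤ τ (m-1)` (digit `b m − 1 ≥ 1` at the target `m`).
[folklore] -/
theorem target_runA {e : ℕ} {i b τ' : ℕ → ℕ} (hie : i e = 1) (hie1 : i (e + 1) = 0)
    (hrec : ∀ s, 1 ≤ s → s ≤ e → i (s - 1) + i (s + 1) = b s * i s) (hb : ∀ s, 1 ≤ s → s ≤ e → 2 ≤ b s)
    {u p m t₂ : ℕ} (hp1 : 1 ≤ p) (hpu : p < u) (hut : u ≤ t₂) (ht₂e : t₂ < e) (hum : u + m = p + t₂ + 1)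
    (hkey : i u + i m = i p + i (t₂ + 1)) (hp : p = 1 ∨ 3 ≤ b p) (hbt : 3 ≤ b (t₂ + 1))
    (h0 : τ' 0 = i 0 - i u) (hA : ∀ s, 1 ≤ s → s < p → τ' s = i s - i (s + 1) - i u)
    (hB : ∀ s, p ≤ s → s < m → τ' s = i s - i (s + 1) + i m - i (t₂ + 1))
    (hC : ∀ s, m ≤ s → s ≤ t₂ → τ' s = i s - i (s + 1) - i (t₂ + 1))
    (hD : ∀ s, t₂ < s → s < e → τ' s = i s - i (s + 1)) (hE : τ' e = 0)
    (τ : ℕ → ℕ) (hτ0 : τ 0 = i 0 - i u) (hτ : ∀ s, 1 ≤ s → s ≤ e → τ s = τ (s - 1) % i s) :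
    i m ≤ τ (m - 1) := by
  have hcert := certificate_runA hie hie1 hrec hb hp1 hpu hut ht₂e hum hkey hp hbt h0 hA hB hC hD hE
  have heq := eq_of_remainder_certificate i τ τ' e (by rw [hτ0, h0]) hτ
    (fun s hs1 hse => (hcert s hs1 hse).imp_right fun ⟨d, hd, _⟩ => ⟨d, hd⟩)
  obtain ⟨_, d, hd, hdig⟩ := hcert m (by omega) (by omega)
  rw [heq (m - 1) (by omega)]
  exact le_of_digit_pos hd (hdig rfl)

/-! ## (N3b) The run source, run reaching `e` -/

/-- **Certificate (N3b).**  Data: `1 ≤ p < u < e`, `u + m = p + e + 1` (so `p + 2 ≤ m ≤ e`), the identity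
`i u + i m = i p` (the four-term identity with `i (e+1) = 0`), `p = 1 ∨ 3 ≤ b p`.  Then `τ' 0 = i 0 − i u`,
`τ' s = i s − i (s+1) − i u` on `[1,p)`, `= i s − i (s+1) + i m` on `[p, m−1)`, `= 0` on `[m−1, e]` is a
greedy-remainder certificate for the class `i 0 − i u`, with digit `b (m-1) − 1 ≥ 1` at `s = m − 1`.
(HAND10G2 §6 (N3), case `t₂ = e`.) [folklore] -/
theorem certificate_runB {e : ℕ} {i b τ' : ℕ → ℕ} (hie : i e = 1) (hie1 : i (e + 1) = 0)
    (hrec : ∀ s, 1 ≤ s → s ≤ e → i (s - 1) + i (s + 1) = b s * i s) (hb : ∀ s, 1 ≤ s → s ≤ e → 2 ≤ b s)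
    {u p m : ℕ} (hp1 : 1 ≤ p) (hpu : p < u) (hue : u < e) (hum : u + m = p + e + 1)
    (hkey : i u + i m = i p) (hp : p = 1 ∨ 3 ≤ b p)
    (h0 : τ' 0 = i 0 - i u) (hA : ∀ s, 1 ≤ s → s < p → τ' s = i s - i (s + 1) - i u)
    (hB : ∀ s, p ≤ s → s + 1 < m → τ' s = i s - i (s + 1) + i m)
    (hZ : ∀ s, m ≤ s + 1 → s ≤ e → τ' s = 0) :
    ∀ s, 1 ≤ s → s ≤ e → τ' s < i s ∧ ∃ d, τ' (s - 1) = τ' s + d * i s ∧ (s + 1 = m → 1 ≤ d) := by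
  intro s hs1 hse
  have h2 := two_mul_le_of_chain hrec hb
  have hrs := hrec s hs1 hse
  have hbs := hb s hs1 hse
  have h2s : 2 * i s ≤ b s * i s := Nat.mul_le_mul_right _ hbs
  have hlt := lt_of_chain hie hie1 h2 s hse
  have hlt' := lt_of_chain hie hie1 h2 (s - 1) (by omega)
  have hs11 : s - 1 + 1 = s := by omega
  rw [hs11] at hlt'
  have his1 : 1 ≤ i s := one_le_of_chain hie hie1 h2 s hse
  have hiu0 : i u ≤ i 0 := le_of_chain hie hie1 h2 0 u (by omega) (by omega)
  have hipu : i u < i p := by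
    have := le_of_chain hie hie1 h2 (p + 1) u (by omega) (by omega)
    have := lt_of_chain hie hie1 h2 p (by omega); omega
  have hims : s + 1 ≤ m → i m ≤ i (s + 1) := fun h => le_of_chain hie hie1 h2 (s + 1) m h (by omega)
  have hgapP : 3 ≤ b p → s + 1 ≤ p → i (s + 1) + i p + 1 ≤ i s :=
    fun h3 h => gap_of_three_le hie hie1 hrec hb p hp1 (by omega) h3 s h
  have hgapP' : 3 ≤ b p → s ≤ p → i s + i p + 1 ≤ i (s - 1) := fun h3 h => by
    have := gap_of_three_le hie hie1 hrec hb p hp1 (by omega) h3 (s - 1) (by omega)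
    rwa [hs11] at this
  have h3p : 3 ≤ b p → 3 * i p ≤ b p * i p := fun h => Nat.mul_le_mul_right _ h
  rcases Nat.lt_or_ge s p with hsp | hsp
  · -- `s < p` (`p ≥ 2`, `3 ≤ b p`)
    have h3 : 3 ≤ b p := by rcases hp with h | h <;> omega
    have e1 : τ' s = i s - i (s + 1) - i u := hA s hs1 hsp
    have hex := hgapP h3 (by omega)
    rcases Nat.lt_or_ge 1 s with hs2 | hs2
    · have e0 : τ' (s - 1) = i (s - 1) - i s - i u := by
        have := hA (s - 1) (by omega) (by omega); rwa [hs11] at this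
      have hex' := hgapP' h3 (by omega)
      refine ⟨by omega, b s - 2, ?_, fun h => by omega⟩
      rw [Nat.sub_mul]; omega
    · have e0 : τ' (s - 1) = i 0 - i u := by rw [show s - 1 = 0 by omega]; exact h0
      have hi0 : i (s - 1) = i 0 := by rw [show s - 1 = 0 by omega]
      refine ⟨by omega, b s - 1, ?_, fun h => by omega⟩
      rw [Nat.sub_mul]; omega
  rcases Nat.lt_or_ge (s + 1) m with hsm | hsm
  · -- `p ≤ s`, `s + 1 < m`
    have e1 : τ' s = i s - i (s + 1) + i m := hB s hsp hsm
    have him1 := hims (by omega)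
    have hlt2 : i m < i (s + 1) := by
      have := lt_of_chain hie hie1 h2 (s + 1) (by omega)
      have := le_of_chain hie hie1 h2 (s + 1 + 1) m (by omega) (by omega); omega
    rcases Nat.lt_or_ge p s with hps | hps
    · have e0 : τ' (s - 1) = i (s - 1) - i s + i m := by
        have := hB (s - 1) (by omega) (by omega); rwa [hs11] at this
      refine ⟨by omega, b s - 2, ?_, fun h => by omega⟩
      rw [Nat.sub_mul]; omega
    · obtain rfl : s = p := le_antisymm hps hsp
      rcases Nat.lt_or_ge 1 s with hs2 | hs2
      · have h3 : 3 ≤ b s := by rcases hp with h | h <;> omega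
        have e0 : τ' (s - 1) = i (s - 1) - i s - i u := by
          have := hA (s - 1) (by omega) (by omega); rwa [hs11] at this
        have hex' := hgapP' h3 le_rfl
        have := h3p h3
        refine ⟨by omega, b s - 3, ?_, fun h => by omega⟩
        rw [Nat.sub_mul]; omega
      · have e0 : τ' (s - 1) = i 0 - i u := by rw [show s - 1 = 0 by omega]; exact h0
        have hi0 : i (s - 1) = i 0 := by rw [show s - 1 = 0 by omega]
        refine ⟨by omega, b s - 2, ?_, fun h => by omega⟩
        rw [Nat.sub_mul]; omega
  · -- `m ≤ s + 1`
    have e1 : τ' s = 0 := hZ s hsm hse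
    rcases Nat.lt_or_ge m (s + 1) with hms | hms
    · -- `m ≤ s`: zero digits
      have e0 : τ' (s - 1) = 0 := hZ (s - 1) (by omega) (by omega)
      exact ⟨by omega, 0, by omega, fun h => by omega⟩
    · -- `s + 1 = m`: the TARGET digit `b (m-1) − 1 ≥ 1`
      have e0 : τ' (s - 1) = i (s - 1) - i s + i m := by
        have := hB (s - 1) (by omega) (by omega); rwa [hs11] at this
      have him : i m = i (s + 1) := by rw [show m = s + 1 by omega]
      refine ⟨by omega, b s - 1, ?_, fun _ => by omega⟩
      rw [Nat.sub_mul]; omega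


/-- **(N3b) for greedy remainders**: under the hypotheses of `certificate_runB`, every `τ` with
`τ 0 = i 0 − i u` obeying the greedy recursion has `i t ≤ τ (t-1)` at the target `t = m − 1`
(digit `b (m-1) − 1 ≥ 1`). [folklore] -/
theorem target_runB {e : ℕ} {i b τ' : ℕ → ℕ} (hie : i e = 1) (hie1 : i (e + 1) = 0)
    (hrec : ∀ s, 1 ≤ s → s ≤ e → i (s - 1) + i (s + 1) = b s * i s) (hb : ∀ s, 1 ≤ s → s ≤ e → 2 ≤ b s)
    {u p m : ℕ} (hp1 : 1 ≤ p) (hpu : p < u) (hue : u < e) (hum : u + m = p + e + 1)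
    (hkey : i u + i m = i p) (hp : p = 1 ∨ 3 ≤ b p)
    (h0 : τ' 0 = i 0 - i u) (hA : ∀ s, 1 ≤ s → s < p → τ' s = i s - i (s + 1) - i u)
    (hB : ∀ s, p ≤ s → s + 1 < m → τ' s = i s - i (s + 1) + i m)
    (hZ : ∀ s, m ≤ s + 1 → s ≤ e → τ' s = 0)
    (τ : ℕ → ℕ) (hτ0 : τ 0 = i 0 - i u) (hτ : ∀ s, 1 ≤ s → s ≤ e → τ s = τ (s - 1) % i s)
    (t : ℕ) (htm : t + 1 = m) : i t ≤ τ (t - 1) := by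
  have hcert := certificate_runB hie hie1 hrec hb hp1 hpu hue hum hkey hp h0 hA hB hZ
  have heq := eq_of_remainder_certificate i τ τ' e (by rw [hτ0, h0]) hτ
    (fun s hs1 hse => (hcert s hs1 hse).imp_right fun ⟨d, hd, _⟩ => ⟨d, hd⟩)
  obtain ⟨_, d, hd, hdig⟩ := hcert t (by omega) (by omega)
  rw [heq (t - 1) (by omega)]
  exact le_of_digit_pos hd (hdig htm)

end Summit.ResolutionOfSingularities.ResolutionOfSingularities.Theorems.HomologicalConductor.PersistenceCyclicQuotientNumeration
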